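import Summits.Ventures.HSemireg.AmplificationChainEtaleFamily
import Summits.Ventures.HSemireg.ArtinianPresentation
import Literature.AlgebraicGeometry.Morphisms.EtaleQuasiSectionOfFormallySmooth
import HarnessLib

/-!
# Venture HSemireg — route (C)'s Hodge-free algebraisation from TWO CITED INPUTS + kernel glue: a Lieblich-type
# VERSAL CHART and EGA IV₄ 17.14.2 / 17.16.3 (i) ⟹ `PerfectLiftsAlgebraise π` ⟹ `PerfectComplexAlgebraisesLifts C`

HONEST FRAMING. Lean index of the computation cell `pub-hsemireg` (theory seat 3, «algebraisation step»). Nothing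
about any explicit variety is asserted; every published input is a hypothesis BY NAME; nothing here says HC, HC_CM
or HC_AV is proved; the g = 4 split case is IN PRINT ([Markman2023GeneralizedKummers] Thm. 1.5 (= Thm. 13.4; J. Eur. Math.
Soc. 25 (2023) p. 236; pre-publication arXiv numbering: Thm. 1.3)) and is RE-DERIVED modulo the named hypotheses. ONE definition — a PREDICATE with parameters (`HasVersalPerfectChartAt`, a conclusion shape); the EGA IV₄ input
is the Literature NAMED FACT `Literature.AlgebraicGeometry.Morphisms.EGAIV_etaleQuasiSection_of_liftsSmallExtensions`
(Prop. 17.14.2 + Cor. 17.16.3 (i), `ℂ`-scheme special case, weaker than print), taken as a hypothesis BY NAME;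
theorems otherwise; no `sorry`, no new axiom.

## What this file does

Seat p7's `PerfectComplexAlgebraisesLifts C` (B25) — the Hodge-free (E)+(C) half of the Monday σ-row — was an
ASSEMBLED assumption («Lieblich 4.2.1 + EGA IV 17.14.2 / 17.16.3 (i) + TT 2.3.1 (d), in the printed shape of
[Perry2022] proof of Prop. 8.1»; audited on paper in the cell file `theory/TH3-ALGEBRAISATION.md` §8 (D1)–(D5)).
`AmplificationChainEtaleFamily.lean` restated it at the OBJECT level (`PerfectLiftsAlgebraise π`) and proved
OBJECT ⟹ CLASSES. THIS FILE proves `PerfectLiftsAlgebraise π` itself from two SEPARATELY CITED inputs, the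
deformation-theoretic composition (D3)–(D5) being KERNEL:

* §6 INPUTS: the Literature fact `EGAIV_etaleQuasiSection_of_liftsSmallExtensions` ([EGAIV4] Prop. 17.14.2 —
  infinitesimal criterion for smoothness AT a point, Artinian test rings with residue field `k(x)` and `𝔪′𝔍′ = 0` —
  + Cor. 17.16.3 (i) — pointed étale quasi-section of a smooth morphism — rendered for `ℂ`-schemes and `ℂ`-points
  with the sub-prescheme weakened to a morphism; imported); `HasVersalPerfectChartAt π s₀ X₀ e E` (def, PREDICATE): a VERSAL algebraic
  family of perfect complexes through `[E]` — an `f : V ⟶ S` locally of finite type, `v₀ ↦ s₀`, a bounded complex of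
  vector bundles `𝒱` on `𝒳 ×_S V` with `𝒱|_{v₀} ≃ E` (roof), VERSAL at `v₀` in test-diagram form, the versality
  clause being typed in EXISTENCE form — a lift `a′` of the `B`-point over the `A`-point exists, NO identification
  `G ≃ a′^*𝒱` is asserted — hence implied by, and WEAKER than, formal smoothness over the moduli problem of a
  Lieblich atlas at `[E]`, which nothing on this chain consumes (PRECISION red-5 W-14; READING NOTE in
  `AmplificationChainVersalChartWitness.lean`) (the chart-level corollary of [Lieblich2006] Thm. 4.2.1 +
  Prop. 2.1.9, with [StacksProject] 0DNZ and [ThomasonTrobaugh1990] 2.3.1 (d) / 2.4.1; assumption BY NAME when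
  asserted).
* §7 `perfectLiftsAlgebraise_of_versalCharts` (PROVED): versal charts + the EGA fact ⟹ `PerfectLiftsAlgebraise π`.
  The glue is (D3): the `B`-point of the chart over a test diagram is `gB^*𝒱`, a bounded complex of vector bundles
  on `X_B` deforming `E` (presentation from `ArtinianPresentation.lean`; `j^* gB^* 𝒱 ≅ (εV ≫ ι_{v₀})^* 𝒱 ≃ E` by
  `Scheme.Modules.pullbackComp` / `pullbackCongr` and the roof, in `D(Mod 𝒪_{X₀})`), seat p7's DERIVED LIFTING
  PROPERTY lifts it to `X_A`, VERSALITY returns the `A`-point of `V`: the infinitesimal criterion holds at `v₀`; then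
  (D4) the EGA fact gives `τ : T ⟶ V` through `v₀` with `τ ≫ f` étale, and (D5) `ℰ := 𝒱` pulled back along
  `𝒳 ×_S T ⟶ 𝒳 ×_S V` carries the identification `ε` and the transported roof at `t₀`.
* §8 ASSEMBLY: the two inputs ⟹ `PerfectComplexAlgebraisesLifts C` for EVERY `C`
  (`perfectComplexAlgebraisesLifts_of_versalCharts_of_EGA`; a smooth `ℂ`-scheme is locally noetherian), and the
  g = 4 σ-row on that trust base (`weilFourfoldsSplit_of_reach_of_pridhamPerfect_of_versalCharts_of_EGA_of_complex`,
  every other binder verbatim p7's).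

STATUS WORDS (cell rules F-1 / W-4). After this file the (E)+(C) half of the Monday σ-row reads: «[EGAIV4] 17.14.2 +
17.16.3 (i) (classical, named fact, special case) ∧ Lieblich-type versal charts (assumption by name; seat corollary
of [Lieblich2006] 4.2.1 / 2.1.9 + 0DNZ + TT — NOT one printed sentence; versality typed in EXISTENCE form — weaker
than Lieblich's formal smoothness, which is not consumed (red-5 W-14)) ∧ KERNEL glue», in place of one assembled
assumption. (F) = `PridhamPerfectLifts C` is untouched. The versal-chart predicate is where a future seat would plug
a typed Lieblich statement (algebraic stack ⟹ smooth atlas ⟹ versal family; its formal smoothness would give MORE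
than the predicate asks).

References: [EGAIV4] Publ. Math. IHÉS 32 (1967), Prop. 17.14.2 (p. 98), 17.16.1, Cor. 17.16.3 (i) (p. 106) ·
[GortzWedhorn2023] Thm. 18.63 · [Lieblich2006] J. Algebraic Geom. 15 (2006), Thm. 4.2.1, Prop. 2.1.9 ·
[StacksProject] Tag 0DNZ, 0DZR · [ThomasonTrobaugh1990] Prop. 2.3.1 (d), 2.4.1 · [Perry2022] Compositio Math. 158
(2022), §7.1 and proof of Prop. 8.1 · [Pridham2024Semiregularity] Cor. 2.25, Rem. 2.27 · [Markman2023GeneralizedKummers]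
Thm. 1.5 (= Thm. 13.4; J. Eur. Math. Soc. 25 (2023) p. 236; pre-publication arXiv numbering: Thm. 1.3) ·
[Deligne1982HodgeCycles] proof of Thm. 4.8.
-/

noncomputable section

open CategoryTheory CategoryTheory.Limits AlgebraicGeometry
open _root_.Topology _root_.Filter
open Literature.AlgebraicGeometry.Motives Literature.AlgebraicGeometry.HodgeTheory
open Literature.AlgebraicGeometry.ModuliOfAbelianVarieties Literature.AlgebraicGeometry.Deligne1982
open Literature.AlgebraicGeometry.KTheory
open Literature.AlgebraicTopology.SingularHomology
open Literature.AlgebraicGeometry.Morphisms (EGAIV_etaleQuasiSection_of_liftsSmallExtensions)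

namespace Summit.Ventures.HSemireg

open Summit.HodgeConjecture.HodgeConjecture
open Summit.HodgeConjecture.HodgeConjecture.WeilTypeLadder
open Summit.HodgeConjecture.HodgeConjecture.Cruxes.HodgeAbelianVarieties.EStepSecantInduction

/-! ## §6 The cited inputs: EGA IV 17 (Literature named fact `EGAIV_etaleQuasiSection_of_liftsSmallExtensions`,
imported) and a Lieblich-type VERSAL CHART (predicate) -/

section Inputs

/-- **A VERSAL algebraic chart for perfect complexes at `E`** (PREDICATE — a conclusion shape; when asserted
for every universally gluable bounded complex of vector bundles it is the chart-level COROLLARY of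
[Lieblich2006] Thm. 4.2.1 (the stack `𝒟^b_{pug}(𝒳/S)` of universally gluable relatively perfect complexes is
an Artin stack locally of finite presentation over `S`) + Prop. 2.1.9 (`Ext^{<0} = 0` makes `[E]` a point)
+ a smooth atlas through `[E]` + [StacksProject, Tag 0DNZ] (a smooth `V ×_𝓜 Spec A → Spec A` has sections
through any `B`-point: formal smoothness of the atlas) + [ThomasonTrobaugh1990] 2.3.1 (d), 2.4.1 (the universal
object on `𝒳 ×_S V`, `V` affine, is quasi-isomorphic to a bounded complex of vector bundles; isomorphisms of the
derived category between such complexes are roofs of quasi-isomorphisms) — an ASSEMBLED statement, grade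
«seat corollary of print»; the kernel links it to nothing). DATA: `f : V ⟶ S` locally of finite type, a
`ℂ`-point `v₀ ↦ s₀`, a bounded complex of vector bundles `𝒱` on `𝒳 ×_S V`, an identification
`εV : X₀ ≅ (𝒳 ×_S V)_{v₀}` compatible with `e` through `𝒳`, a roof of quasi-isomorphisms
`E ← P → (εV ≫ ι_{v₀})^*𝒱` (CENTRE: `𝒱|_{v₀} ≃ E`); VERSALITY at `v₀` in test-diagram form (binders of seat p7's
`PerfectLiftsOverArtinianPointsAt` plus a `B`-point `b` of `V` centred at `v₀` over the `A`-point `a` of `S` and a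
presentation `gB : X_B ⟶ 𝒳 ×_S V` of `X_B` as the base change along `b`): for every bounded complex of vector
bundles `G` on `X_A` with `i^*G ≅ gB^*𝒱` in `D(Mod 𝒪_{X_B})` there EXISTS an `A`-point `a′` of `V` lifting `b`
over `a`. PRECISION (red-5 W-14): this versality clause is typed in EXISTENCE form — the identification
`G ≃ a′^*𝒱` on `X_A` that formal smoothness of a Lieblich atlas at `[E]` would supply is NOT part of it — so the
predicate is implied by, and WEAKER than, that formal smoothness; the existence form is all the glue (D3) of §7
consumes (READING NOTE and the kernel inhabitant `hasVersalPerfectChartAt_unit` in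
`AmplificationChainVersalChartWitness.lean`).
[cite: Lieblich2006, Thm. 4.2.1 and Prop. 2.1.9] [cite: ThomasonTrobaugh1990, Prop. 2.3.1 (d)]
[cite: StacksProject, Tag 0DNZ] [cite: Perry2022, §7.1 and proof of Prop. 8.1] -/
def HasVersalPerfectChartAt {𝒳 S : SchemeOver ℂ} (π : 𝒳 ⟶ S) (s₀ : ComplexPoints S) (X₀ : SchemeOver ℂ)
    (e : X₀ ≅ fiberOver π s₀) (E : CochainComplex X₀.left.Modules ℤ) : Prop :=
  ∃ (V : SchemeOver ℂ) (f : V ⟶ S) (_ : LocallyOfFiniteType f.left) (v₀ : ComplexPoints V)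
    (_ : AlgPoints.map f v₀ = s₀)
    (𝒱 : CochainComplex (familyPullback π f).left.Modules ℤ) (_ : IsBoundedVBComplex 𝒱)
    (εV : X₀ ≅ fiberOver (familyPullback.snd π f) v₀)
    (_ : εV.hom ≫ fiberι (familyPullback.snd π f) v₀ ≫ familyPullback.fst π f = e.hom ≫ fiberι π s₀)
    (P : CochainComplex X₀.left.Modules ℤ) (_ : IsBoundedVBComplex P)
    (φ : P ⟶ ((Scheme.Modules.pullback (εV.hom ≫ fiberι (familyPullback.snd π f) v₀).left).mapHomologicalComplex
      (ComplexShape.up ℤ)).obj 𝒱)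
    (ψ : P ⟶ E) (_ : QuasiIso φ ∧ QuasiIso ψ),
    ∀ (A B : Type) [CommRing A] [Algebra ℂ A] [IsArtinianRing A] [IsLocalRing A]
      [CommRing B] [Algebra ℂ B] (φAB : A →ₐ[ℂ] B), Function.Surjective φAB →
      IsLocalRing.maximalIdeal A * RingHom.ker φAB = ⊥ →
      ∀ (ρ : B →ₐ[ℂ] ℂ) (a : specOver ℂ A ⟶ S) (b : specOver ℂ B ⟶ V),
        Spec.map (CommRingCat.ofHom ρ.toRingHom) ≫ b.left = v₀.left →
        b.left ≫ f.left = Spec.map (CommRingCat.ofHom φAB.toRingHom) ≫ a.left →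
        ∀ ⦃XA XB : Scheme⦄ (gA : XA ⟶ 𝒳.left) (qA : XA ⟶ Spec (.of A)),
          IsPullback gA qA π.left a.left →
          ∀ (i : XB ⟶ XA) (qB : XB ⟶ Spec (.of B)),
            IsPullback i qB qA (Spec.map (CommRingCat.ofHom φAB.toRingHom)) →
            ∀ (gB : XB ⟶ (familyPullback π f).left),
              IsPullback gB qB (familyPullback.snd π f).left b.left →
              gB ≫ (familyPullback.fst π f).left = i ≫ gA →
              ∀ (G : CochainComplex XA.Modules ℤ), IsBoundedVBComplex G →
                (letI := HasDerivedCategory.standard XB.Modules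
                 Nonempty (DerivedCategory.Q.obj
                    (((Scheme.Modules.pullback i).mapHomologicalComplex (ComplexShape.up ℤ)).obj G) ≅
                   DerivedCategory.Q.obj
                    (((Scheme.Modules.pullback gB).mapHomologicalComplex (ComplexShape.up ℤ)).obj 𝒱))) →
                ∃ a' : specOver ℂ A ⟶ V,
                  Spec.map (CommRingCat.ofHom φAB.toRingHom) ≫ a'.left = b.left ∧ a' ≫ f = a

end Inputs

/-! ## §7 THE GLUE: versal chart + lifting property ⟹ formally smooth chart ⟹ étale quasi-section ⟹
## the object-level étale shape (proved) -/

section Glue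

variable {𝒳 S : SchemeOver ℂ} (π : 𝒳 ⟶ S)

/-- **Derived-liftable perfect complexes with a versal algebraic chart ALGEBRAISE over an étale neighbourhood**
(PROVED from the two named inputs): if every universally gluable bounded complex of vector bundles on a model of
a fibre of `π` has a versal chart (`HasVersalPerfectChartAt`, Lieblich-type; versality in EXISTENCE form, weaker
than Lieblich's formal smoothness — red-5 W-14) and the pointed étale quasi-section
statement [EGAIV4, 17.14.2 + 17.16.3 (i)] holds, then `PerfectLiftsAlgebraise π`: the derived small-extension
lifting property at `s₀` (seat p7's `PerfectLiftsOverArtinianPointsAt`) composed with VERSALITY gives the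
infinitesimal lifting criterion for `V → S` at `v₀` (this is theory seat 3's (D3): the `B`-point of the chart is
the restriction `gB^*𝒱`, a bounded complex of vector bundles on `X_B` deforming `E` — the Artinian presentation
is CONSTRUCTED, `exists_artinianPresentation`), the EGA fact gives `τ : T ⟶ V` through `v₀` with `τ ≫ f` étale,
and `ℰ := 𝒱` pulled back to `𝒳 ×_S T` carries the roof at `t₀` ((D4)–(D5); the class bookkeeping is then
`perfectComplexAlgebraisesLifts_of_perfectLiftsAlgebraise`). [cite: EGAIV4, Prop. 17.14.2 and Cor. 17.16.3 (i)]
[cite: Lieblich2006, Thm. 4.2.1] [cite: Perry2022, proof of Prop. 8.1] -/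
theorem perfectLiftsAlgebraise_of_versalCharts (hEGA : EGAIV_etaleQuasiSection_of_liftsSmallExtensions)
    [IsLocallyNoetherian S.left]
    (hV : ∀ (s₀ : ComplexPoints S) (X₀ : SchemeOver ℂ) (e : X₀ ≅ fiberOver π s₀)
      (E : CochainComplex X₀.left.Modules ℤ), IsBoundedVBComplex E →
      (∀ k : ℤ, k < 0 → extRank X₀ E k = 0) → HasVersalPerfectChartAt π s₀ X₀ e E) :
    PerfectLiftsAlgebraise π := by
  intro s₀ X₀ e E hE hneg hlift
  obtain ⟨V, f, hfT, v₀, hv₀, 𝒱, h𝒱, εV, hεV, P, hP, φ, ψ, ⟨hφ, hψ⟩, versal⟩ := hV s₀ X₀ e E hE hneg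
  haveI := hfT
  -- the cartesian square of the chart family `𝒳 ×_S V`
  have hR : IsPullback (familyPullback.fst π f).left (familyPullback.snd π f).left π.left f.left :=
    IsPullback.of_hasPullback _ _
  -- (G1) the infinitesimal lifting criterion for `f` at `v₀`
  have hlc : ∀ (A B : Type) [CommRing A] [Algebra ℂ A] [IsArtinianRing A] [IsLocalRing A]
      [CommRing B] [Algebra ℂ B] (φAB : A →ₐ[ℂ] B), Function.Surjective φAB →
      IsLocalRing.maximalIdeal A * RingHom.ker φAB = ⊥ →
      ∀ (ρ : B →ₐ[ℂ] ℂ) (a : specOver ℂ A ⟶ S) (b : specOver ℂ B ⟶ V),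
        Spec.map (CommRingCat.ofHom ρ.toRingHom) ≫ b.left = v₀.left →
        b.left ≫ f.left = Spec.map (CommRingCat.ofHom φAB.toRingHom) ≫ a.left →
        ∃ a' : specOver ℂ A ⟶ V, Spec.map (CommRingCat.ofHom φAB.toRingHom) ≫ a'.left = b.left ∧ a' ≫ f = a := by
    intro A B _ _ _ _ _ _ φAB hsurj hsmall ρ a b hb₀ hsq
    -- the closed point of `a` is `s₀`
    have ha : Spec.map (CommRingCat.ofHom (ρ.comp φAB).toRingHom) ≫ a.left = s₀.left := by
      have hc : Spec.map (CommRingCat.ofHom (ρ.comp φAB).toRingHom) =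
          Spec.map (CommRingCat.ofHom ρ.toRingHom) ≫ Spec.map (CommRingCat.ofHom φAB.toRingHom) := by
        rw [← Spec.map_comp]
        rfl
      calc Spec.map (CommRingCat.ofHom (ρ.comp φAB).toRingHom) ≫ a.left
          = Spec.map (CommRingCat.ofHom ρ.toRingHom) ≫ Spec.map (CommRingCat.ofHom φAB.toRingHom) ≫ a.left := by
            rw [hc, Category.assoc]
        _ = Spec.map (CommRingCat.ofHom ρ.toRingHom) ≫ b.left ≫ f.left :=
            congrArg (fun x => Spec.map (CommRingCat.ofHom ρ.toRingHom) ≫ x) hsq.symm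
        _ = (Spec.map (CommRingCat.ofHom ρ.toRingHom) ≫ b.left) ≫ f.left := (Category.assoc _ _ _).symm
        _ = v₀.left ≫ f.left := by rw [hb₀]; rfl
        _ = s₀.left := congrArg (fun x => x.left) hv₀
    obtain ⟨XA, XB, gA, qA, hA, i, qB, hB, j, hj, hje⟩ := exists_artinianPresentation π s₀ X₀ e φAB ρ a ha
    -- the base-change map `gB : X_B ⟶ 𝒳 ×_S V` over `b`
    have hsqB : (i ≫ gA) ≫ π.left = (qB ≫ b.left) ≫ f.left :=
      calc (i ≫ gA) ≫ π.left = i ≫ gA ≫ π.left := Category.assoc _ _ _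
        _ = i ≫ qA ≫ a.left := by rw [hA.w]
        _ = (i ≫ qA) ≫ a.left := (Category.assoc _ _ _).symm
        _ = (qB ≫ Spec.map (CommRingCat.ofHom φAB.toRingHom)) ≫ a.left := by rw [hB.w]
        _ = qB ≫ Spec.map (CommRingCat.ofHom φAB.toRingHom) ≫ a.left := Category.assoc _ _ _
        _ = qB ≫ b.left ≫ f.left := congrArg (fun x => qB ≫ x) hsq.symm
        _ = (qB ≫ b.left) ≫ f.left := (Category.assoc _ _ _).symm
    have houterB : IsPullback (i ≫ gA) qB π.left (b.left ≫ f.left) := by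
      have h := hB.paste_horiz hA
      rw [← hsq] at h
      exact h
    have hgB : IsPullback (hR.lift (i ≫ gA) (qB ≫ b.left) hsqB) qB (familyPullback.snd π f).left b.left :=
      IsPullback.of_right' houterB hR
    set gB := hR.lift (i ≫ gA) (qB ≫ b.left) hsqB with hgBdef
    have hgBfst : gB ≫ (familyPullback.fst π f).left = i ≫ gA := hR.lift_fst _ _ _
    have hgBsnd : gB ≫ (familyPullback.snd π f).left = qB ≫ b.left := hR.lift_snd _ _ _
    -- `j ≫ gB` IS the map along which the CENTRE roof is given
    have hjg : j ≫ gB = (εV.hom ≫ fiberι (familyPullback.snd π f) v₀).left := by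
      apply hR.hom_ext
      · rw [Category.assoc, hgBfst, hje, ← Over.comp_left, ← Over.comp_left, Category.assoc, hεV]
      · rw [Category.assoc, hgBsnd, ← Category.assoc, hj.w, Category.assoc, hb₀, ← Over.comp_left,
          Category.assoc, fiberι_comp, ← Category.assoc, Over.comp_left, Over.comp_left,
          left_comp_fiberOverToSpec_left]
        rfl
    -- the `B`-point of the chart: `F := gB^* 𝒱`, a bounded complex of vector bundles on `X_B` with `j^*F ≅ E` in `D`
    let F := ((Scheme.Modules.pullback gB).mapHomologicalComplex (ComplexShape.up ℤ)).obj 𝒱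
    have hF : IsBoundedVBComplex F := h𝒱.pullback gB
    have hjF : letI := HasDerivedCategory.standard X₀.left.Modules
        Nonempty (DerivedCategory.Q.obj
          (((Scheme.Modules.pullback j).mapHomologicalComplex (ComplexShape.up ℤ)).obj F) ≅
          DerivedCategory.Q.obj E) := by
      letI := HasDerivedCategory.standard X₀.left.Modules
      -- `j^* gB^* 𝒱 ≅ (j ≫ gB)^* 𝒱 = (εV ≫ ι_{v₀})^* 𝒱` termwise
      let ι₁ : ((Scheme.Modules.pullback j).mapHomologicalComplex (ComplexShape.up ℤ)).obj F ≅
          ((Scheme.Modules.pullback (εV.hom ≫ fiberι (familyPullback.snd π f) v₀).left).mapHomologicalComplex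
            (ComplexShape.up ℤ)).obj 𝒱 :=
        (NatIso.mapHomologicalComplex (Scheme.Modules.pullbackComp j gB ≪≫ Scheme.Modules.pullbackCongr hjg)
          (ComplexShape.up ℤ)).app 𝒱
      haveI := (DerivedCategory.isIso_Q_map_iff_quasiIso _ φ).mpr hφ
      haveI := (DerivedCategory.isIso_Q_map_iff_quasiIso _ ψ).mpr hψ
      exact ⟨DerivedCategory.Q.mapIso ι₁ ≪≫ (asIso (DerivedCategory.Q.map φ)).symm ≪≫
        asIso (DerivedCategory.Q.map ψ)⟩
    -- the DERIVED LIFTING PROPERTY gives `G` on `X_A`; VERSALITY gives the `A`-point of `V`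
    obtain ⟨G, hG, hGi⟩ := hlift A B φAB hsurj hsmall ρ a ha gA qA hA i qB hB j hj hje F hF hjF
    exact versal A B φAB hsurj hsmall ρ a b hb₀ hsq gA qA hA i qB hB gB hgB hgBfst G hG hGi
  -- (G2) the pointed étale quasi-section
  obtain ⟨T, τ, t₀, ht₀, hét⟩ := hEGA f v₀ hlc
  subst hv₀
  subst ht₀
  -- (G3) the étale family: `ρ := τ ≫ f`, `ℰ := 𝒱` pulled back along `𝒳 ×_S T ⟶ 𝒳 ×_S V`
  have hsqm : pullback.fst π.left (τ ≫ f).left ≫ π.left = (pullback.snd π.left (τ ≫ f).left ≫ τ.left) ≫ f.left := by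
    rw [pullback.condition, Category.assoc]
    rfl
  let m : (familyPullback π (τ ≫ f)).left ⟶ (familyPullback π f).left :=
    hR.lift (pullback.fst π.left (τ ≫ f).left) (pullback.snd π.left (τ ≫ f).left ≫ τ.left) hsqm
  have hmfst : m ≫ (familyPullback.fst π f).left = (familyPullback.fst π (τ ≫ f)).left := hR.lift_fst _ _ _
  have hmsnd : m ≫ (familyPullback.snd π f).left = (familyPullback.snd π (τ ≫ f)).left ≫ τ.left :=
    hR.lift_snd _ _ _
  let ℰ := ((Scheme.Modules.pullback m).mapHomologicalComplex (ComplexShape.up ℤ)).obj 𝒱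
  have hℰ : IsBoundedVBComplex ℰ := h𝒱.pullback m
  -- the point bookkeeping: `(τ ≫ f)(t₀) = f(τ t₀)`
  have hpt : AlgPoints.map (τ ≫ f) t₀ = AlgPoints.map f (AlgPoints.map τ t₀) := AlgPoints.map_comp_apply τ f t₀
  -- the identification `ε : X₀ ≅ (𝒳 ×_S T)_{t₀}`
  let ε : X₀ ≅ fiberOver (familyPullback.snd π (τ ≫ f)) t₀ :=
    εV ≪≫ fiberOverFamilyPullbackIso π f (AlgPoints.map τ t₀) ≪≫
      eqToIso (congrArg (fiberOver π) hpt.symm) ≪≫ (fiberOverFamilyPullbackIso π (τ ≫ f) t₀).symm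
  have hε : ε.hom ≫ fiberι (familyPullback.snd π (τ ≫ f)) t₀ ≫ familyPullback.fst π (τ ≫ f) =
      e.hom ≫ fiberι π (AlgPoints.map f (AlgPoints.map τ t₀)) := by
    simp only [ε, Iso.trans_hom, Iso.symm_hom, eqToIso.hom, Category.assoc]
    rw [← fiberOverFamilyPullbackIso_hom_fiberι π (τ ≫ f) t₀, Iso.inv_hom_id_assoc,
      eqToHom_comp_fiberι' π hpt.symm, fiberOverFamilyPullbackIso_hom_fiberι π f, hεV]
  -- `(ε ≫ ι_{t₀}) ≫ m = εV ≫ ι_{v₀}` on schemes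
  have hκ : (ε.hom ≫ fiberι (familyPullback.snd π (τ ≫ f)) t₀).left ≫ m =
      (εV.hom ≫ fiberι (familyPullback.snd π f) (AlgPoints.map τ t₀)).left := by
    apply hR.hom_ext
    · rw [Category.assoc, hmfst, ← Over.comp_left, Category.assoc, hε, ← Over.comp_left, Category.assoc, hεV]
    · rw [Category.assoc, hmsnd, ← Category.assoc, ← Over.comp_left, Category.assoc, fiberι_comp,
        ← Category.assoc ε.hom, Over.comp_left, Over.comp_left, left_comp_fiberOverToSpec_left,
        ← Over.comp_left, Category.assoc, Category.assoc εV.hom, fiberι_comp, ← Category.assoc εV.hom,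
        Over.comp_left, Over.comp_left, left_comp_fiberOverToSpec_left]
      rfl
  -- the roof at `t₀`: transport `φ` along `(ε ≫ ι_{t₀})^* ℰ ≅ (εV ≫ ι_{v₀})^* 𝒱`
  let ι₂ : ((Scheme.Modules.pullback (εV.hom ≫ fiberι (familyPullback.snd π f) (AlgPoints.map τ t₀)).left).mapHomologicalComplex
        (ComplexShape.up ℤ)).obj 𝒱 ≅
      ((Scheme.Modules.pullback (ε.hom ≫ fiberι (familyPullback.snd π (τ ≫ f)) t₀).left).mapHomologicalComplex
        (ComplexShape.up ℤ)).obj ℰ :=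
    (NatIso.mapHomologicalComplex
        (Scheme.Modules.pullbackCongr hκ.symm ≪≫
          (Scheme.Modules.pullbackComp (ε.hom ≫ fiberι (familyPullback.snd π (τ ≫ f)) t₀).left m).symm)
        (ComplexShape.up ℤ)).app 𝒱
  haveI := hφ
  haveI := hψ
  exact ⟨T, τ ≫ f, hét, t₀, hpt, ℰ, hℰ, ε, hε, P, hP, φ ≫ ι₂.hom, ψ, inferInstance, hψ⟩

end Glue

/-! ## §8 ASSEMBLY: the two cited inputs ⟹ p7's `PerfectComplexAlgebraisesLifts C` (every `C`) ⟹ the g = 4 row -/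

section Assembly

/-- **(Lieblich-type versal charts on every smooth projective family over a smooth base) ∧ (EGA IV 17.14.2 +
17.16.3 (i)) ⟹ `PerfectComplexAlgebraisesLifts C` for EVERY Chern character theory `C`** (PROVED): a smooth
`ℂ`-scheme is locally noetherian (locally of finite type over the field `ℂ`), so §7 applies, and §3 turns the
object-level conclusion into classes. (`HasVersalPerfectChartAt`: versality in EXISTENCE form, weaker than
Lieblich's formal smoothness, which is not consumed — red-5 W-14.) [cite: EGAIV4, Prop. 17.14.2 and Cor. 17.16.3 (i)]
[cite: Lieblich2006, Thm. 4.2.1] [cite: Fulton1998, §15.1 (ii)] -/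
theorem perfectComplexAlgebraisesLifts_of_versalCharts_of_EGA
    (hEGA : EGAIV_etaleQuasiSection_of_liftsSmallExtensions)
    (hV : ∀ ⦃𝒳 S : SchemeOver ℂ⦄ (π : 𝒳 ⟶ S) (n : ℕ),
      IsSmoothProjectiveFamily π n → _root_.AlgebraicGeometry.Smooth S.hom →
      ∀ (s₀ : ComplexPoints S) (X₀ : SchemeOver ℂ) (e : X₀ ≅ fiberOver π s₀)
        (E : CochainComplex X₀.left.Modules ℤ), IsBoundedVBComplex E →
        (∀ k : ℤ, k < 0 → extRank X₀ E k = 0) → HasVersalPerfectChartAt π s₀ X₀ e E)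
    (C : ChernCharacterBetti) : PerfectComplexAlgebraisesLifts C :=
  perfectComplexAlgebraisesLifts_of_perfectLiftsAlgebraise (fun 𝒳 S π n hπ hS => by
    haveI := hS
    haveI : IsLocallyNoetherian S.left := LocallyOfFiniteType.isLocallyNoetherian S.hom
    exact perfectLiftsAlgebraise_of_versalCharts π hEGA (hV π n hπ hS)) C

variable {C : ChernCharacterBetti}

/-- **g = 4, route (C), σ-TIER, on the CITED trust base for the Hodge-free half.** BY NAME:
`weilFamilyReach_hyperbolic` (Deligne, refereed tree fact), `PridhamPerfectLifts C` ([Pridham2024Semiregularity]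
Cor. 2.25 + Rem. 2.27, venture-typed by seat p7), the EGA IV 17 fact (`EGAIV_etaleQuasiSection_of_liftsSmallExtensions`,
classical) and Lieblich-type versal charts (`HasVersalPerfectChartAt` for every universally gluable bounded complex
of vector bundles on every smooth projective family over a smooth base — the chart-level corollary of
[Lieblich2006] Thm. 4.2.1, assumption by name; PRECISION (red-5 W-14): its versality clause is typed in EXISTENCE
form — implied by, and WEAKER than, formal smoothness of a Lieblich atlas at the chart point, which is NOT
consumed); the (D3)–(D5) glue is KERNEL (§5–§7). BY VALUE: verbatim p7's
`weilFourfoldsSplit_of_reach_of_pridhamPerfect_of_algebraisesLifts_of_complex`. Conclusion: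
`Stubs.WeilAlgebraicSplitHyperplane 2 d` (in print: [Markman2023GeneralizedKummers] Thm. 1.5 (= Thm. 13.4; J. Eur. Math. Soc. 25 (2023) p. 236; pre-publication arXiv numbering: Thm. 1.3);
re-derived, no new case). [cite: Markman2023GeneralizedKummers, Theorem 1.5 (= Theorem 13.4), p. 236 (the case in print; arXiv:1805.11574 pre-publication numbering: Theorem 1.3)]
[cite: Pridham2024Semiregularity, Cor. 2.25; Rem. 2.27] [cite: EGAIV4, Prop. 17.14.2 and Cor. 17.16.3 (i)]
[cite: Lieblich2006, Thm. 4.2.1] [cite: Deligne1982HodgeCycles, proof of Thm. 4.8] -/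
theorem weilFourfoldsSplit_of_reach_of_pridhamPerfect_of_versalCharts_of_EGA_of_complex
    (hF : weilFamilyReach_hyperbolic) (hP : PridhamPerfectLifts C)
    (hEGA : EGAIV_etaleQuasiSection_of_liftsSmallExtensions)
    (hV : ∀ ⦃𝒳 S : SchemeOver ℂ⦄ (π : 𝒳 ⟶ S) (n : ℕ),
      IsSmoothProjectiveFamily π n → _root_.AlgebraicGeometry.Smooth S.hom →
      ∀ (s₀ : ComplexPoints S) (X₀ : SchemeOver ℂ) (e : X₀ ≅ fiberOver π s₀)
        (E : CochainComplex X₀.left.Modules ℤ), IsBoundedVBComplex E →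
        (∀ k : ℤ, k < 0 → extRank X₀ E k = 0) → HasVersalPerfectChartAt π s₀ X₀ e E)
    {d : ℕ} (hd : 0 < d)
    (P : AbelianVariety ℂ) (ψ₀ : P ⟶ P) (e : ProjectiveEmbedding P.X) (a : complexBetti (projectiveSpace e.n ℂ) 2)
    (hP4 : P.dim = 2 * 2) (hψ : ψ₀ ≫ ψ₀ = -(d • 𝟙 P)) (ha : IsRationalClass a) (ha0 : a ≠ 0)
    (hhyp : IsHyperbolicWeilType P ψ₀ 2 (symmetrisedClass d P ψ₀ e a))
    (w : complexBetti P.X (2 * 2)) (hwW : w ∈ weilClassesOf P ψ₀ 2 d) (hwr : IsRationalClass w) (hw0 : w ≠ 0)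
    (I : Finset ℕ) (hI : ∀ p : ℕ, 1 ≤ p → p ≤ 2 * 2 → p ∈ I) (E : CochainComplex P.X.left.Modules ℤ)
    (hE : IsBoundedVBComplex E) (hneg : ∀ k : ℤ, k < 0 → extRank P.X E k = 0) (h0 : extRank P.X E 0 = 1)
    (a' b' : ℤ) [E.IsStrictlyGE a'] [E.IsStrictlyLE b']
    (hσ : letI := HasDerivedCategory.standard P.X.left.Modules
      HomComplex.IsISemiregularC P.X E a' b' hE.isFiniteLocallyFree {q | q + 1 ∈ I})
    (q : ℚ) (c : ℕ → ℚ)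
    (hch2 : chPerfect C P.X E hE.isFiniteLocallyFree 2 = ((q : ℚ) : ℂ) • cupPowTwo (symmetrisedClass d P ψ₀ e a) 2 + w)
    (hchp : ∀ p ∈ I, p ≠ 2 →
      chPerfect C P.X E hE.isFiniteLocallyFree p = ((c p : ℚ) : ℂ) • cupPowTwo (symmetrisedClass d P ψ₀ e a) p) :
    Stubs.WeilAlgebraicSplitHyperplane 2 d :=
  weilFourfoldsSplit_of_reach_of_pridhamPerfect_of_algebraisesLifts_of_complex hF hP
    (perfectComplexAlgebraisesLifts_of_versalCharts_of_EGA hEGA hV C) hd P ψ₀ e a hP4 hψ ha ha0 hhyp w hwW hwr hw0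
    I hI E hE hneg h0 a' b' hσ q c hch2 hchp

end Assembly

/-! ## Audit: what is assumed, what is proved
ASSUMED BY NAME in §8's row: `weilFamilyReach_hyperbolic` (refereed), `PridhamPerfectLifts C` (printed + refereed
statement, venture-typed, undischarged), `EGAIV_etaleQuasiSection_of_liftsSmallExtensions` (Literature fact, classical;
special case, weaker than print), `HasVersalPerfectChartAt` for every universally gluable bounded complex of vector bundles on every
smooth projective family over a smooth base (seat corollary of [Lieblich2006] 4.2.1 whose versality clause is in
EXISTENCE form — weaker than Lieblich's formal smoothness, which nothing here consumes (red-5 W-14) —, kernel-linked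
to nothing) — and the census object BY VALUE. PROVED: §7 (the (D3)–(D5) glue), §8 (assembly through
`AmplificationChainEtaleFamily`'s object ⟹ classes and p7's row). NOT here: Lieblich's theorem itself (algebraic
stack ⟹ smooth atlas ⟹ versal chart, formally smooth), HC_CM, CM density, Mumford–Tate finiteness. -/

end Summit.Ventures.HSemireg

end
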